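import Mathlib
import Literature.MathematicalPhysics.QuantumLattice.ThinSectorFoldArcsineSum
import HarnessLib

/-!
# Four-sector counting, fold ranges: the TWO-REGIME ROW SUM (log-free total of the thin anti-diagonal counts)

Topic `Literature/MathematicalPhysics/QuantumLattice`; sub-namespace `BandSectorCounting` (generic grid calculus / bookkeeping, continues
`ThinSectorFoldArcsineSum`).  Part (F3c) of the log-free ANISOTROPIC anchored four-sector counting lemma («E1-P2-THIN-COUNT», cell gate-hubbard-kl,
plan g17 (R41); seat p4; plan HOME/prover-p4/E1-P2-THIN-COUNT-PLAN.md §Refinement 4).  The fold ranges of the four-leg count are summed row by row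
(`σ`-rows of the anti-diagonal fibration, BGM 2006 App. A2 even shift); per row the affine-tolerance fold count (`gridCount_L5_affine`) costs
`P·2(L_σ/w + 1)` cells with `L_σ = 2√(δ_σ/c) + 2δ₁/c` (`|D(σ)| ≤ 2δ′_σ`) / `2δ_σ√(2M)/(c√|D(σ)|) + 2δ₁/c` (else), `δ_σ = C₀w² + C₂w·m_σ` the THIN tolerance
(`m_σ` = distance of the row to the forward point).  Summed through the dyadic level counts of the diagonal function `D` this gives the isotropic
`N log N`; here the rows are classified instead — (B) `|D| ≤ 2δ′`: few rows (`Λ`, a single fat level) of cost `√δ_max/w`; (A) `|D| > η₀″`: `O(1)` each;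
(C) `|D′| > η₁″`: EMPTY (the cells of the fold range carry both partials `< λ ≪ η₁″`); (D) near-critical near-zero rows, by the alignment dichotomy:
ALIGNED rows have the quadratic floor `D ≥ c_Q m_σ²` (aligned rigidity + forward point), so `δ_σ/√D ≤ w√(C₀/2) + C₂w/√c_Q` — `O(1)` per row, NO
logarithm; ANTI-aligned rows with `D > δ′` are KILLED (one-sided fibre), and those with `D < −2δ′` are summed by the arcsine lemma
(`sum_inv_sqrt_near_min_le`) in blocks of diameter `R/4` around the critical points (`exists_critical_near`).  Pure bookkeeping over abstract row data:

* **`sum_inv_sqrt_nearCritical_le`** — `Σ_{rows : |D| ≤ η₀″, |D′| ≤ η₁″, D ≤ −φ} 1/√|D| ≤ (4Nh/R + 1)·(4/√φ + 11/(√c₂ h))` (blocks + arcsine);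
* **`row_two_regime_le`** — the per-row classification bound; **`sum_rows_two_regime_le`** — the total
  `Σ_rows A_σ ≤ N(c₀ + c_A + c_+) + c_B·Λ + c_arc·(4Nh/R + 1)·(4/√(2C₀w²) + 11/(√c₂ h))`.

Everything is PROVED; no definitions, no named facts.

## Sources

* G. Benfatto, A. Giuliani, V. Mastropietro, Ann. Henri Poincaré 7 (2006) 809–898, Lemma 3.1 / (2.80) / App. A2–A3. [BenfattoGiulianiMastropietro2006]
* V. Mastropietro, *Non-Perturbative Renormalization* (World Scientific, 2008), ch. 14, (14.67) p. 223 (anisotropic count, no `|h|`); p. 229. [Mastropietro2008]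
-/

noncomputable section

open Real Set

namespace Literature.MathematicalPhysics.QuantumLattice.BandSectorCounting

/-- Mean-value bound: `|f t − f s| ≤ C|t − s|` from `|f′| ≤ C`. [folklore] -/
private theorem abs_sub_le_of_deriv_bound {f f' : ℝ → ℝ} (hf : ∀ z, HasDerivAt f (f' z) z) {C : ℝ} (hC : ∀ z, |f' z| ≤ C) (s t : ℝ) :
    |f t - f s| ≤ C * |t - s| := by
  have h := Convex.norm_image_sub_le_of_norm_hasDerivWithin_le (fun z _ => (hf z).hasDerivWithinAt)
    (fun z _ => by rw [Real.norm_eq_abs]; exact hC z) (convex_uIcc s t) left_mem_uIcc right_mem_uIcc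
  simpa [Real.norm_eq_abs] using h

/-! ## §1 The near-critical negative rows: blocks around the critical points and the arcsine lemma -/

/-- **The arcsine total over all near-critical near-zero negative rows.**  `D` with `|D′| ≤ M₁`, `|D″| ≤ A`, `c₂ ≤ D″` on the stratum
`{|D| ≤ η₀, |D′| ≤ η₁}`; thresholds `η₀″ + M₁R ≤ η₀`, `η₁″ + AR ≤ η₁`, `η₁″ ≤ c₂R/4`.  On a grid `xᵢ = x₀ + i·h`, `i < N`:
`Σ_{i : |D(xᵢ)| ≤ η₀″, |D′(xᵢ)| ≤ η₁″, D(xᵢ) ≤ −φ} 1/√|D(xᵢ)| ≤ (4Nh/R + 1)·(4/√φ + 11/(√c₂·h))` — rows grouped in blocks of diameter `≤ R/4`, each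
block inside the convex window of the critical point next to it. [cite: BenfattoGiulianiMastropietro2006, Lemma 3.1 / App. A2–A3] -/
theorem sum_inv_sqrt_nearCritical_le {g g' g'' : ℝ → ℝ} (hg : ∀ z, HasDerivAt g (g' z) z) (hg' : ∀ z, HasDerivAt g' (g'' z) z)
    {c₂ M₁ A η₀ η₁ η₀'' η₁'' R φ : ℝ} (hc₂ : 0 < c₂) (hR : 0 < R) (hφ : 0 < φ)
    (hM₁ : ∀ z, |g' z| ≤ M₁) (hA : ∀ z, |g'' z| ≤ A)
    (hstrat : ∀ z, |g z| ≤ η₀ → |g' z| ≤ η₁ → c₂ ≤ g'' z)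
    (hη₀ : η₀'' + M₁ * R ≤ η₀) (hη₁ : η₁'' + A * R ≤ η₁) (hη₁R : η₁'' ≤ c₂ * R / 4)
    {x₀ h : ℝ} (hh : 0 < h) (N : ℕ) :
    ∑ i ∈ (Finset.range N).filter (fun i : ℕ => |g (x₀ + i * h)| ≤ η₀'' ∧ |g' (x₀ + i * h)| ≤ η₁'' ∧ g (x₀ + i * h) ≤ -φ),
        1 / Real.sqrt |g (x₀ + i * h)| ≤ (4 * (N * h) / R + 1) * (4 / Real.sqrt φ + 11 / (Real.sqrt c₂ * h)) := by
  set x : ℕ → ℝ := fun i => x₀ + i * h with hxdef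
  set F := (Finset.range N).filter (fun i : ℕ => |g (x i)| ≤ η₀'' ∧ |g' (x i)| ≤ η₁'' ∧ g (x i) ≤ -φ) with hF
  set W := 4 / Real.sqrt φ + 11 / (Real.sqrt c₂ * h) with hW
  have hW0 : 0 ≤ W := by rw [hW]; positivity
  change ∑ i ∈ F, 1 / Real.sqrt |g (x i)| ≤ (4 * (N * h) / R + 1) * W
  have hmemF : ∀ i, i ∈ F ↔ i < N ∧ |g (x i)| ≤ η₀'' ∧ |g' (x i)| ≤ η₁'' ∧ g (x i) ≤ -φ := fun i => by
    rw [hF, Finset.mem_filter, Finset.mem_range]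
  -- block length `Lb`: block diameter `(Lb − 1) h ≤ R/4`, and `Lb > R/(4h)`
  set Lb : ℕ := ⌊R / (4 * h)⌋₊ + 1 with hLb
  have hLbpos : 0 < Lb := by rw [hLb]; omega
  have hLbR : ((Lb : ℝ) - 1) * h ≤ R / 4 := by
    have h1 : ((⌊R / (4 * h)⌋₊ : ℕ) : ℝ) ≤ R / (4 * h) := Nat.floor_le (by positivity)
    rw [hLb]; push_cast
    rw [show ((⌊R / (4 * h)⌋₊ : ℕ) : ℝ) + 1 - 1 = ⌊R / (4 * h)⌋₊ by ring]
    calc ((⌊R / (4 * h)⌋₊ : ℕ) : ℝ) * h ≤ R / (4 * h) * h := mul_le_mul_of_nonneg_right h1 hh.le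
      _ = R / 4 := by field_simp
  have hLbR' : R / (4 * h) < Lb := by rw [hLb]; push_cast; exact Nat.lt_floor_add_one _
  -- the fibres of `i ↦ i / Lb`
  have hmaps : ∀ i ∈ F, i / Lb ∈ Finset.range (N / Lb + 1) := by
    intro i hi
    rw [Finset.mem_range]
    exact Nat.lt_succ_of_le (Nat.div_le_div_right ((hmemF i).1 hi).1.le)
  rw [← Finset.sum_fiberwise_of_maps_to hmaps]
  -- each fibre is inside the convex window of a critical point: arcsine bound `≤ W`
  have hfibre : ∀ b : ℕ, ∑ i ∈ F.filter (fun i => i / Lb = b), 1 / Real.sqrt |g (x i)| ≤ W := by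
    intro b
    rcases (F.filter (fun i => i / Lb = b)).eq_empty_or_nonempty with he | ⟨i₀, hi₀⟩
    · rw [he, Finset.sum_empty]; exact hW0
    rw [Finset.mem_filter] at hi₀
    obtain ⟨hi₀F, hb₀⟩ := hi₀
    obtain ⟨-, hg₀, hg'₀, -⟩ := (hmemF i₀).1 hi₀F
    set z₀ := x i₀ with hz₀
    -- the stratum holds on `[z₀ − R, z₀ + R]`
    have hwin : ∀ z ∈ Icc (z₀ - R) (z₀ + R), c₂ ≤ g'' z := by
      intro z hz
      have hzz : |z - z₀| ≤ R := by rw [abs_le]; constructor <;> linarith [hz.1, hz.2]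
      have hM₁0 : 0 ≤ M₁ := (abs_nonneg _).trans (hM₁ 0)
      have hA0 : 0 ≤ A := (abs_nonneg _).trans (hA 0)
      have h1 := abs_sub_le_of_deriv_bound hg hM₁ z₀ z
      have h2 := abs_sub_le_of_deriv_bound hg' hA z₀ z
      refine hstrat z ?_ ?_
      · calc |g z| = |(g z - g z₀) + g z₀| := by ring_nf
          _ ≤ |g z - g z₀| + |g z₀| := abs_add_le _ _
          _ ≤ M₁ * R + η₀'' := add_le_add (h1.trans (mul_le_mul_of_nonneg_left hzz hM₁0)) hg₀
          _ ≤ η₀ := by linarith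
      · calc |g' z| = |(g' z - g' z₀) + g' z₀| := by ring_nf
          _ ≤ |g' z - g' z₀| + |g' z₀| := abs_add_le _ _
          _ ≤ A * R + η₁'' := add_le_add (h2.trans (mul_le_mul_of_nonneg_left hzz hA0)) hg'₀
          _ ≤ η₁ := by linarith
    obtain ⟨σc, hcrit, hσc⟩ := exists_critical_near hg' hc₂ hwin hg'₀ (by nlinarith)
    have hσcR : |σc - z₀| ≤ R / 4 := hσc.trans (by rw [div_le_iff₀ hc₂]; linarith)
    have hlo' : ∀ z ∈ Icc (σc - R / 2) (σc + R / 2), c₂ ≤ g'' z := by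
      intro z hz
      have := abs_le.1 hσcR
      exact hwin z ⟨by linarith [hz.1], by linarith [hz.2]⟩
    have key := sum_inv_sqrt_near_min_le hg hg' hc₂ hlo' hcrit hφ hh N (x₀ := x₀)
    refine le_trans (Finset.sum_le_sum_of_subset_of_nonneg ?_ fun i _ _ => by positivity) key
    intro i hi
    rw [Finset.mem_filter] at hi
    obtain ⟨hiF, hib⟩ := hi
    obtain ⟨hiN, -, -, hgi⟩ := (hmemF i).1 hiF
    rw [Finset.mem_filter, Finset.mem_range]
    refine ⟨hiN, ?_, hgi⟩
    -- same block ⇒ `|x i − z₀| ≤ (Lb − 1) h ≤ R/4`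
    have hdi : |x i - z₀| ≤ R / 4 := by
      have e1 := Nat.div_add_mod i Lb
      have e2 := Nat.div_add_mod i₀ Lb
      rw [hib] at e1; rw [hb₀] at e2
      have r1 := Nat.mod_lt i hLbpos
      have r2 := Nat.mod_lt i₀ hLbpos
      have hii : |(i : ℝ) - i₀| ≤ (Lb : ℝ) - 1 := by
        have c1 : (i : ℝ) = (Lb : ℝ) * b + (i % Lb : ℕ) := by exact_mod_cast e1.symm
        have c2 : (i₀ : ℝ) = (Lb : ℝ) * b + (i₀ % Lb : ℕ) := by exact_mod_cast e2.symm
        have d1 : ((i % Lb : ℕ) : ℝ) ≤ (Lb : ℝ) - 1 := by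
          have : i % Lb + 1 ≤ Lb := r1
          have := (Nat.cast_le (α := ℝ)).2 this; push_cast at this; linarith
        have d2 : ((i₀ % Lb : ℕ) : ℝ) ≤ (Lb : ℝ) - 1 := by
          have : i₀ % Lb + 1 ≤ Lb := r2
          have := (Nat.cast_le (α := ℝ)).2 this; push_cast at this; linarith
        have d3 : (0 : ℝ) ≤ (i % Lb : ℕ) := Nat.cast_nonneg _
        have d4 : (0 : ℝ) ≤ (i₀ % Lb : ℕ) := Nat.cast_nonneg _
        rw [c1, c2, abs_le]; constructor <;> linarith
      have e : x i - z₀ = ((i : ℝ) - i₀) * h := by rw [hz₀]; simp only [hxdef]; ring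
      rw [e, abs_mul, abs_of_pos hh]
      calc |(i : ℝ) - i₀| * h ≤ ((Lb : ℝ) - 1) * h := mul_le_mul_of_nonneg_right hii hh.le
        _ ≤ R / 4 := hLbR
    have h1 := abs_le.1 hdi; have h2 := abs_le.1 hσcR
    constructor <;> [skip; skip] <;> simp only [hxdef] at h1 ⊢ <;> linarith
  -- number of blocks
  have hblocks : (((N / Lb + 1 : ℕ)) : ℝ) ≤ 4 * (N * h) / R + 1 := by
    push_cast
    have h1 : ((N / Lb : ℕ) : ℝ) ≤ (N : ℝ) / Lb := Nat.cast_div_le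
    have h2 : (N : ℝ) / Lb ≤ (N : ℝ) / (R / (4 * h)) :=
      div_le_div_of_nonneg_left (Nat.cast_nonneg N) (by positivity) hLbR'.le
    have h3 : (N : ℝ) / (R / (4 * h)) = 4 * (N * h) / R := by field_simp
    linarith
  calc ∑ b ∈ Finset.range (N / Lb + 1), ∑ i ∈ F.filter (fun i => i / Lb = b), 1 / Real.sqrt |g (x i)|
      ≤ ∑ b ∈ Finset.range (N / Lb + 1), W := Finset.sum_le_sum fun b _ => hfibre b
    _ = ((N / Lb + 1 : ℕ) : ℝ) * W := by rw [Finset.sum_const, Finset.card_range, nsmul_eq_mul]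
    _ ≤ (4 * (N * h) / R + 1) * W := mul_le_mul_of_nonneg_right hblocks hW0

/-! ## §2 The per-row classification and the total -/

section Rows

variable {g g' g'' : ℝ → ℝ} (hg : ∀ z, HasDerivAt g (g' z) z) (hg' : ∀ z, HasDerivAt g' (g'' z) z)
  {c₂ M₁ A η₀ η₁ η₀'' η₁'' R : ℝ} (hc₂ : 0 < c₂) (hR : 0 < R) (hη₀'' : 0 < η₀'')
  (hM₁ : ∀ z, |g' z| ≤ M₁) (hA : ∀ z, |g'' z| ≤ A)
  (hstrat : ∀ z, |g z| ≤ η₀ → |g' z| ≤ η₁ → c₂ ≤ g'' z)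
  (hη₀ : η₀'' + M₁ * R ≤ η₀) (hη₁ : η₁'' + A * R ≤ η₁) (hη₁R : η₁'' ≤ c₂ * R / 4)
  {x₀ h : ℝ} (hh : 0 < h) {N : ℕ}
  -- row data
  (Acnt m : ℕ → ℝ) (Ali Anti : ℕ → Prop)
  {w C₀ C₂ δ₁ τ Pc c M cQ mM : ℝ} (hw : 0 < w) (hC₀ : 0 < C₀) (hC₂ : 0 ≤ C₂) (hδ₁ : 0 ≤ δ₁) (hτ : 0 < τ) (hPc : 0 ≤ Pc)
  (hc : 0 < c) (hM : 0 < M) (hcQ : 0 < cQ) (hm : ∀ i, 0 ≤ m i ∧ m i ≤ mM)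
  (hRow : ∀ i, i < N → Acnt i ≤ Pc * (2 * ((if |g (x₀ + i * h)| ≤ 2 * ((C₀ * w ^ 2 + C₂ * w * m i) + δ₁ * τ)
      then 2 * Real.sqrt ((C₀ * w ^ 2 + C₂ * w * m i) / c) + 2 * δ₁ / c
      else 2 * (C₀ * w ^ 2 + C₂ * w * m i) * Real.sqrt (2 * M) / (c * Real.sqrt |g (x₀ + i * h)|) + 2 * δ₁ / c) / w + 1)))
  (hC : ∀ i, i < N → η₁'' < |g' (x₀ + i * h)| → Acnt i ≤ 0)
  (hDich : ∀ i, i < N → |g (x₀ + i * h)| ≤ η₀'' → |g' (x₀ + i * h)| ≤ η₁'' → Ali i ∨ Anti i)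
  (hKill : ∀ i, i < N → Anti i → |g (x₀ + i * h)| ≤ η₀'' → |g' (x₀ + i * h)| ≤ η₁'' →
      (C₀ * w ^ 2 + C₂ * w * m i) + δ₁ * τ < g (x₀ + i * h) → Acnt i ≤ 0)
  (hAli : ∀ i, i < N → Ali i → |g (x₀ + i * h)| ≤ η₀'' → |g' (x₀ + i * h)| ≤ η₁'' → cQ * m i ^ 2 ≤ g (x₀ + i * h))
include hw hC₀ hC₂ hδ₁ hτ hPc hc hM hcQ hm hRow hC hDich hKill hAli hη₀''

/-- **Per-row classification.**  Every row satisfies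
`A_i ≤ c₀ + c_B·𝟙[|D_i| ≤ 2(δ_M + δ₁τ)] + c_A + c_+ + c_arc·𝟙[|D_i| ≤ η₀″ ∧ |D′_i| ≤ η₁″ ∧ D_i ≤ −2C₀w²]/√|D_i|` with
`c₀ = 2P + 4Pδ₁/(cw)`, `c_B = (2P/w)·2√(δ_M/c)`, `c_A = (2P/w)·2δ_M√(2M)/(c√η₀″)`, `c_+ = (4P√(2M)/c)(√(C₀/2) + C₂/√c_Q)`, `c_arc = (2P/w)·2δ_M√(2M)/c`,
`δ_M = C₀w² + C₂w·m_M`. [cite: BenfattoGiulianiMastropietro2006, Lemma 3.1 / (2.80) / App. A2] -/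
theorem row_two_regime_le (i : ℕ) (hi : i < N) :
    Acnt i ≤ (2 * Pc + 4 * Pc * δ₁ / (c * w)) +
      (if |g (x₀ + i * h)| ≤ 2 * ((C₀ * w ^ 2 + C₂ * w * mM) + δ₁ * τ) then (2 * Pc / w) * (2 * Real.sqrt ((C₀ * w ^ 2 + C₂ * w * mM) / c)) else 0) +
      (2 * Pc / w) * (2 * (C₀ * w ^ 2 + C₂ * w * mM) * Real.sqrt (2 * M) / (c * Real.sqrt η₀'')) +
      (4 * Pc * Real.sqrt (2 * M) / c) * (Real.sqrt (C₀ / 2) + C₂ / Real.sqrt cQ) +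
      (if |g (x₀ + i * h)| ≤ η₀'' ∧ |g' (x₀ + i * h)| ≤ η₁'' ∧ g (x₀ + i * h) ≤ -(2 * C₀ * w ^ 2)
        then (2 * Pc / w) * (2 * (C₀ * w ^ 2 + C₂ * w * mM) * Real.sqrt (2 * M) / c) / Real.sqrt |g (x₀ + i * h)| else 0) := by
  set D := g (x₀ + i * h) with hD
  set D' := g' (x₀ + i * h) with hD'
  set δi := C₀ * w ^ 2 + C₂ * w * m i with hδi
  set δM := C₀ * w ^ 2 + C₂ * w * mM with hδM
  obtain ⟨hmi0, hmiM⟩ := hm i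
  have hw2 : 0 < w ^ 2 := by positivity
  have hC₂w : 0 ≤ C₂ * w := mul_nonneg hC₂ hw.le
  have hδi0 : C₀ * w ^ 2 ≤ δi := by rw [hδi]; nlinarith [mul_nonneg hC₂w hmi0]
  have hδipos : 0 < δi := lt_of_lt_of_le (by positivity) hδi0
  have hδiM : δi ≤ δM := by rw [hδi, hδM]; nlinarith [mul_le_mul_of_nonneg_left hmiM hC₂w]
  have hδM0 : 0 < δM := hδipos.trans_le hδiM
  -- names for the five constants
  set c₀ := 2 * Pc + 4 * Pc * δ₁ / (c * w) with hc₀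
  set cB := (2 * Pc / w) * (2 * Real.sqrt (δM / c)) with hcB
  set cA := (2 * Pc / w) * (2 * δM * Real.sqrt (2 * M) / (c * Real.sqrt η₀'')) with hcA
  set cP := (4 * Pc * Real.sqrt (2 * M) / c) * (Real.sqrt (C₀ / 2) + C₂ / Real.sqrt cQ) with hcP
  set cR := (2 * Pc / w) * (2 * δM * Real.sqrt (2 * M) / c) with hcR
  have hc₀0 : 0 ≤ c₀ := by rw [hc₀]; positivity
  have hcB0 : 0 ≤ cB := by rw [hcB]; positivity
  have hcA0 : 0 ≤ cA := by rw [hcA]; positivity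
  have hcP0 : 0 ≤ cP := by rw [hcP]; positivity
  have hcR0 : 0 ≤ cR := by rw [hcR]; positivity
  have hind1 : 0 ≤ (if |D| ≤ 2 * (δM + δ₁ * τ) then cB else 0) := by split_ifs <;> [exact hcB0; exact le_rfl]
  have hind2 : 0 ≤ (if |D| ≤ η₀'' ∧ |D'| ≤ η₁'' ∧ D ≤ -(2 * C₀ * w ^ 2) then cR / Real.sqrt |D| else 0) := by
    split_ifs <;> [positivity; exact le_rfl]
  have hrow := hRow i hi
  change Acnt i ≤ Pc * (2 * ((if |D| ≤ 2 * (δi + δ₁ * τ) then 2 * Real.sqrt (δi / c) + 2 * δ₁ / c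
      else 2 * δi * Real.sqrt (2 * M) / (c * Real.sqrt |D|) + 2 * δ₁ / c) / w + 1)) at hrow
  change Acnt i ≤ c₀ + (if |D| ≤ 2 * (δM + δ₁ * τ) then cB else 0) + cA + cP +
      (if |D| ≤ η₀'' ∧ |D'| ≤ η₁'' ∧ D ≤ -(2 * C₀ * w ^ 2) then cR / Real.sqrt |D| else 0)
  by_cases hB : |D| ≤ 2 * (δi + δ₁ * τ)
  · -- class (B)
    rw [if_pos hB] at hrow
    have hBM : |D| ≤ 2 * (δM + δ₁ * τ) := hB.trans (by linarith)
    rw [if_pos hBM]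
    have hs : Real.sqrt (δi / c) ≤ Real.sqrt (δM / c) := Real.sqrt_le_sqrt (div_le_div_of_nonneg_right hδiM hc.le)
    have e : Pc * (2 * ((2 * Real.sqrt (δi / c) + 2 * δ₁ / c) / w + 1)) = c₀ + (2 * Pc / w) * (2 * Real.sqrt (δi / c)) := by
      rw [hc₀]; field_simp; ring
    rw [e] at hrow
    have : (2 * Pc / w) * (2 * Real.sqrt (δi / c)) ≤ cB := by
      rw [hcB]; exact mul_le_mul_of_nonneg_left (by linarith) (by positivity)
    linarith [hind2]
  · -- class (¬B): `|D| > 2δ′_i ≥ 2C₀w²`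
    rw [if_neg hB] at hrow
    push Not at hB
    have hDbig : 2 * C₀ * w ^ 2 < |D| := by nlinarith [hB, hδi0, hδ₁, hτ.le]
    have hDpos : 0 < |D| := lt_trans (by positivity) hDbig
    have hsD : 0 < Real.sqrt |D| := Real.sqrt_pos.2 hDpos
    have e : Pc * (2 * ((2 * δi * Real.sqrt (2 * M) / (c * Real.sqrt |D|) + 2 * δ₁ / c) / w + 1)) =
        c₀ + (4 * Pc * Real.sqrt (2 * M) / (c * w)) * (δi / Real.sqrt |D|) := by
      rw [hc₀]; field_simp; ring
    rw [e] at hrow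
    set κ := 4 * Pc * Real.sqrt (2 * M) / (c * w) with hκ
    have hκ0 : 0 ≤ κ := by rw [hκ]; positivity
    by_cases hC' : η₁'' < |D'|
    · -- class (C): no cells
      have := hC i hi hC'
      linarith [hind1, hind2]
    push Not at hC'
    by_cases hA' : η₀'' < |D|
    · -- class (A): `δ_i/√|D| ≤ δ_M/√η₀″`
      have h1 : δi / Real.sqrt |D| ≤ δM / Real.sqrt η₀'' := by
        rw [div_le_div_iff₀ hsD (Real.sqrt_pos.2 hη₀'')]
        exact mul_le_mul hδiM (Real.sqrt_le_sqrt hA'.le) (Real.sqrt_nonneg _) hδM0.le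
      have h2 : κ * (δi / Real.sqrt |D|) ≤ cA := by
        calc κ * (δi / Real.sqrt |D|) ≤ κ * (δM / Real.sqrt η₀'') := mul_le_mul_of_nonneg_left h1 hκ0
          _ = cA := by rw [hκ, hcA]; field_simp; ring
      linarith [hind1, hind2]
    push Not at hA'
    -- class (D): near-critical near-zero row; the dichotomy
    rcases hDich i hi hA' hC' with hal | han
    · -- aligned: quadratic floor
      have hQ := hAli i hi hal hA' hC'
      have hD0 : 0 < D := by
        have h0 : 0 ≤ D := le_trans (by positivity) hQ
        rcases h0.eq_or_lt with h0 | h0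
        · exfalso; rw [← h0, abs_zero] at hDpos; exact lt_irrefl _ hDpos
        · exact h0
      have habsD : |D| = D := abs_of_pos hD0
      rw [habsD] at hDbig hsD
      -- `C₀w² ≤ w√(C₀/2)·√D` and `C₂ w m_i ≤ (C₂ w/√c_Q)·√D`
      have t1 : C₀ * w ^ 2 ≤ w * Real.sqrt (C₀ / 2) * Real.sqrt D := by
        have hs2 : Real.sqrt (2 * C₀ * w ^ 2) ≤ Real.sqrt D := Real.sqrt_le_sqrt hDbig.le
        have e1 : Real.sqrt (2 * C₀ * w ^ 2) = w * Real.sqrt (2 * C₀) := by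
          rw [show 2 * C₀ * w ^ 2 = w ^ 2 * (2 * C₀) by ring, Real.sqrt_mul (by positivity), Real.sqrt_sq hw.le]
        have e3 : Real.sqrt (C₀ / 2) * Real.sqrt (2 * C₀) = C₀ := by
          rw [← Real.sqrt_mul (by positivity), show C₀ / 2 * (2 * C₀) = C₀ ^ 2 by ring, Real.sqrt_sq hC₀.le]
        have e2 : C₀ * w ^ 2 = w * Real.sqrt (C₀ / 2) * (w * Real.sqrt (2 * C₀)) := by
          calc C₀ * w ^ 2 = w * w * (Real.sqrt (C₀ / 2) * Real.sqrt (2 * C₀)) := by rw [e3]; ring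
            _ = _ := by ring
        rw [e2, ← e1]
        exact mul_le_mul_of_nonneg_left hs2 (by positivity)
      have t2 : C₂ * w * m i ≤ (C₂ * w / Real.sqrt cQ) * Real.sqrt D := by
        have hs3 : Real.sqrt (cQ * m i ^ 2) ≤ Real.sqrt D := Real.sqrt_le_sqrt hQ
        rw [Real.sqrt_mul hcQ.le, Real.sqrt_sq hmi0] at hs3
        have hscQ : 0 < Real.sqrt cQ := Real.sqrt_pos.2 hcQ
        calc C₂ * w * m i = (C₂ * w / Real.sqrt cQ) * (Real.sqrt cQ * m i) := by field_simp
          _ ≤ (C₂ * w / Real.sqrt cQ) * Real.sqrt D := mul_le_mul_of_nonneg_left hs3 (by positivity)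
      have h1 : δi / Real.sqrt D ≤ w * (Real.sqrt (C₀ / 2) + C₂ / Real.sqrt cQ) := by
        rw [div_le_iff₀ hsD, hδi]
        calc C₀ * w ^ 2 + C₂ * w * m i ≤ w * Real.sqrt (C₀ / 2) * Real.sqrt D + (C₂ * w / Real.sqrt cQ) * Real.sqrt D := add_le_add t1 t2
          _ = w * (Real.sqrt (C₀ / 2) + C₂ / Real.sqrt cQ) * Real.sqrt D := by ring
      have h2 : κ * (δi / Real.sqrt |D|) ≤ cP := by
        rw [habsD]
        calc κ * (δi / Real.sqrt D) ≤ κ * (w * (Real.sqrt (C₀ / 2) + C₂ / Real.sqrt cQ)) := mul_le_mul_of_nonneg_left h1 hκ0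
          _ = cP := by rw [hκ, hcP]; field_simp
      linarith [hind1, hind2]
    · -- anti-aligned: killed or arcsine row
      by_cases hk : δi + δ₁ * τ < D
      · have := hKill i hi han hA' hC' hk
        linarith [hind1, hind2]
      · push Not at hk
        have hDneg : D ≤ -(2 * C₀ * w ^ 2) := by
          have hlt : D < 0 := by
            by_contra h0; push Not at h0
            rw [abs_of_nonneg h0] at hB; linarith
          rw [abs_of_neg hlt] at hDbig; linarith
        have hif : (if |D| ≤ η₀'' ∧ |D'| ≤ η₁'' ∧ D ≤ -(2 * C₀ * w ^ 2) then cR / Real.sqrt |D| else 0) = cR / Real.sqrt |D| :=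
          if_pos ⟨hA', hC', hDneg⟩
        rw [hif]
        have h1 : κ * (δi / Real.sqrt |D|) ≤ cR / Real.sqrt |D| := by
          have e1 : κ * (δi / Real.sqrt |D|) = (κ * δi) / Real.sqrt |D| := by ring
          have e2 : cR = κ * δM := by rw [hcR, hκ]; field_simp; ring
          rw [e1, e2]
          exact div_le_div_of_nonneg_right (mul_le_mul_of_nonneg_left hδiM hκ0) hsD.le
        linarith [hind1]

include hg hg' hc₂ hR hM₁ hA hstrat hη₀ hη₁ hη₁R hh in
/-- **The two-regime total.**  Summing `row_two_regime_le` over the rows: with `Λ ≥ #{rows : |D| ≤ 2(δ_M + δ₁τ)}` (one fat level of the diagonal level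
count) and the arcsine total (`sum_inv_sqrt_nearCritical_le` at `φ = 2C₀w²`),
`Σ_{i<N} A_i ≤ N(c₀ + c_A + c_+) + c_B·Λ + c_arc·(4Nh/R + 1)(4/√(2C₀w²) + 11/(√c₂ h))` — with `h, w ≍` cell width every term is `O(1/w)`: the fold ranges
of the thin anchored count carry NO logarithm. [cite: BenfattoGiulianiMastropietro2006, Lemma 3.1 / (2.80) / App. A2–A3] -/
theorem sum_rows_two_regime_le {Λ : ℝ}
    (hLev : ((((Finset.range N).filter fun i : ℕ => |g (x₀ + i * h)| ≤ 2 * ((C₀ * w ^ 2 + C₂ * w * mM) + δ₁ * τ)).card : ℝ)) ≤ Λ) :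
    ∑ i ∈ Finset.range N, Acnt i ≤
      N * ((2 * Pc + 4 * Pc * δ₁ / (c * w)) + (2 * Pc / w) * (2 * (C₀ * w ^ 2 + C₂ * w * mM) * Real.sqrt (2 * M) / (c * Real.sqrt η₀'')) +
          (4 * Pc * Real.sqrt (2 * M) / c) * (Real.sqrt (C₀ / 2) + C₂ / Real.sqrt cQ)) +
        (2 * Pc / w) * (2 * Real.sqrt ((C₀ * w ^ 2 + C₂ * w * mM) / c)) * Λ +
        (2 * Pc / w) * (2 * (C₀ * w ^ 2 + C₂ * w * mM) * Real.sqrt (2 * M) / c) *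
          ((4 * (N * h) / R + 1) * (4 / Real.sqrt (2 * C₀ * w ^ 2) + 11 / (Real.sqrt c₂ * h))) := by
  set δM := C₀ * w ^ 2 + C₂ * w * mM with hδM
  set c₀ := 2 * Pc + 4 * Pc * δ₁ / (c * w) with hc₀
  set cB := (2 * Pc / w) * (2 * Real.sqrt (δM / c)) with hcB
  set cA := (2 * Pc / w) * (2 * δM * Real.sqrt (2 * M) / (c * Real.sqrt η₀'')) with hcA
  set cP := (4 * Pc * Real.sqrt (2 * M) / c) * (Real.sqrt (C₀ / 2) + C₂ / Real.sqrt cQ) with hcP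
  set cR := (2 * Pc / w) * (2 * δM * Real.sqrt (2 * M) / c) with hcR
  have hw2 : 0 < w ^ 2 := by positivity
  have hδM0 : 0 < δM := by
    obtain ⟨h0, h1⟩ := hm 0
    have : 0 ≤ C₂ * w * mM := mul_nonneg (mul_nonneg hC₂ hw.le) (h0.trans h1)
    rw [hδM]; nlinarith [mul_pos hC₀ hw2]
  have hcB0 : 0 ≤ cB := by rw [hcB]; positivity
  have hcR0 : 0 ≤ cR := by rw [hcR]; positivity
  -- sum the per-row bound
  have hsum := Finset.sum_le_sum fun i hi =>
    row_two_regime_le hη₀'' Acnt m Ali Anti hw hC₀ hC₂ hδ₁ hτ hPc hc hM hcQ hm hRow hC hDich hKill hAli i (Finset.mem_range.1 hi)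
  refine hsum.trans ?_
  rw [Finset.sum_add_distrib, Finset.sum_add_distrib, Finset.sum_add_distrib, Finset.sum_add_distrib, Finset.sum_const, Finset.sum_const,
    Finset.sum_const, Finset.card_range, nsmul_eq_mul, nsmul_eq_mul, nsmul_eq_mul]
  -- the class-(B) indicator
  have hBsum : ∑ i ∈ Finset.range N, (if |g (x₀ + i * h)| ≤ 2 * (δM + δ₁ * τ) then cB else 0) ≤ cB * Λ := by
    rw [← Finset.sum_filter, Finset.sum_const, nsmul_eq_mul, mul_comm]
    exact mul_le_mul_of_nonneg_left hLev hcB0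
  -- the arcsine indicator
  have hRsum : ∑ i ∈ Finset.range N, (if |g (x₀ + i * h)| ≤ η₀'' ∧ |g' (x₀ + i * h)| ≤ η₁'' ∧ g (x₀ + i * h) ≤ -(2 * C₀ * w ^ 2)
      then cR / Real.sqrt |g (x₀ + i * h)| else 0) ≤ cR * ((4 * (N * h) / R + 1) * (4 / Real.sqrt (2 * C₀ * w ^ 2) + 11 / (Real.sqrt c₂ * h))) := by
    rw [← Finset.sum_filter]
    have e : ∀ i, cR / Real.sqrt |g (x₀ + i * h)| = cR * (1 / Real.sqrt |g (x₀ + i * h)|) := fun i => by ring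
    simp_rw [e]
    rw [← Finset.mul_sum]
    refine mul_le_mul_of_nonneg_left ?_ hcR0
    exact sum_inv_sqrt_nearCritical_le hg hg' hc₂ hR (by positivity) hM₁ hA hstrat hη₀ hη₁ hη₁R hh N
  change (N : ℝ) * c₀ + ∑ i ∈ Finset.range N, (if |g (x₀ + i * h)| ≤ 2 * (δM + δ₁ * τ) then cB else 0) + N * cA + N * cP +
      ∑ i ∈ Finset.range N, (if |g (x₀ + i * h)| ≤ η₀'' ∧ |g' (x₀ + i * h)| ≤ η₁'' ∧ g (x₀ + i * h) ≤ -(2 * C₀ * w ^ 2)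
        then cR / Real.sqrt |g (x₀ + i * h)| else 0) ≤
    N * (c₀ + cA + cP) + cB * Λ + cR * ((4 * (N * h) / R + 1) * (4 / Real.sqrt (2 * C₀ * w ^ 2) + 11 / (Real.sqrt c₂ * h)))
  nlinarith [hBsum, hRsum]

end Rows

end Literature.MathematicalPhysics.QuantumLattice.BandSectorCounting

end
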